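import Summits.Ventures.GridStability.Models.InverterNetwork
import Literature.Analysis.ODE.MaxLyapunovInvariance

/-!
# GridStability/Models/DroopVoltageBox — an invariant VOLTAGE BOX for the droop-controlled microgrid with Q–V dynamics (certificate-free, every `n`, angles and frequencies arbitrary)

Cell `gridfusion` (LADDER-GRIDFUSION, apex line G3.b «droop microgrid WITH voltage dynamics» — the first
apex object that is not a classical machine model, models/MODEL-3-NOTES.md §0 row N1; seat
gridfusion-model-3 (g7)). The full printed model [cite: KunduEtAl2019, eqs. (4a)–(4c), (5a)–(5b)]
(= [cite: ShinZavala2020, (8a)–(8c)], typed `DroopMicrogrid.field`, p464230) carries the voltage loop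
`τ_Qi V̇_i = v_i⁰ − V_i + λ^q_i (Q_i^set − Q_i(θ, V))`, `Q_i = Σ_j V_iV_j (G_ij sin θ_ij − B_ij cos θ_ij)`.
Its polar state is meaningful only for `V_i ≥ 0`; every G3.b small-signal row (#51, #68) is about a rest
point with `V* > 0`. This file certifies a GLOBAL structural fact about the voltage magnitudes alone.

WHAT IS CERTIFIED (kernel; Nagumo-type box invariance through the tree's
`Literature.Analysis.ODE.forall_le_of_hasDerivWithinAt_of_eq_imp_deriv_neg`, no certificate, no kit).
Hypotheses: `τ_Qi > 0`, `λ^q_i ≥ 0`, `b_i := v_i⁰ + λ^q_i Q_i^set > 0` (lower face), and WEAK SUSCEPTANCE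
DOMINANCE `Σ_{j≠i} (|G_ij| + |B_ij|) ≤ −B_ii` (upper face; the Kron-reduced self-susceptance dominates
the couplings). Then for every `M > max_i b_i` and every solution on `[0, T]` with `0 ≤ V_i(0) ≤ M`:
`0 ≤ V_i(t) ≤ M` for all `t ∈ [0, T]` and all `i` — WHATEVER the angles and frequencies do
(`voltage_box_invariant`). Faces: at `V_i = 0` the injection `Q_i` vanishes and `V̇_i = b_i/τ_Qi > 0`
(`dV_at_zero`); at `V_i = M` with all `V_j ∈ [0, M]`, `Q_i ≥ M² (−B_ii − Σ_{j≠i}(|G_ij| + |B_ij|)) ≥ 0`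
(`Q_lower_at_top`) so `τ_Qi V̇_i ≤ b_i − M < 0`.

THREE COLUMNS. CERTIFIED: the invariance (std axioms). MODELLED: (4a)–(4c) AS PRINTED (MV-6N: reduced
network, measurement filters, no limiter, no inner loops); the dominance hypothesis is a property of the
REDUCED admittance data (true self-susceptance `B_ii` required — instance files that list `B_ii := 0` as
unused do not qualify). Nothing about synchronisation, voltage regulation quality, or stability of any
device; an invariant box is not an attractor statement. VALIDATED: nothing.
-/

noncomputable section

open Real Set Finset

namespace Summit.Ventures.GridStability.Models.DroopMicrogrid

variable {n : ℕ} (mg : DroopMicrogrid n)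

/-! ## §1 The two faces -/

/-- Lower face: at `V_i = 0` the reactive injection of node `i` vanishes, `Q_i(θ, V) = 0`. -/
theorem Q_eq_zero_of_zero (θ V : Fin n → ℝ) (i : Fin n) (hVi : V i = 0) : mg.Q θ V i = 0 := by
  unfold Q
  exact sum_eq_zero fun j _ => by rw [hVi]; ring

/-- Hence `V̇_i = (v_i⁰ + λ^q_i Q_i^set)/τ_Qi` on the face `V_i = 0` (any angles, any other voltages). -/
theorem dV_at_zero (x : State n) (i : Fin n) (hVi : x.2.2 i = 0) :
    mg.dV x i = (mg.Vset i + mg.kQ i * mg.Qset i) / mg.τQ i := by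
  unfold dV
  rw [mg.Q_eq_zero_of_zero x.1 x.2.2 i hVi, hVi]
  ring

/-- Upper face: if `V_i = M ≥ 0` and every `V_j ∈ [0, M]`, then
`Q_i(θ, V) ≥ M² (−B_ii − Σ_{j≠i} (|G_ij| + |B_ij|))` for ALL angle configurations `θ`. -/
theorem Q_lower_at_top (θ V : Fin n → ℝ) (i : Fin n) {M : ℝ} (hM : 0 ≤ M) (hVi : V i = M)
    (hbox : ∀ j, 0 ≤ V j ∧ V j ≤ M) :
    M ^ 2 * (-mg.B i i - ∑ j ∈ univ.erase i, (|mg.G i j| + |mg.B i j|)) ≤ mg.Q θ V i := by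
  classical
  unfold Q
  rw [← Finset.add_sum_erase univ _ (mem_univ i)]
  simp only [sub_self, sin_zero, cos_zero, mul_zero, zero_sub, mul_one]
  rw [hVi, mul_sub, mul_sum]
  have hterm : ∀ j ∈ univ.erase i,
      -(M ^ 2 * (|mg.G i j| + |mg.B i j|))
        ≤ M * V j * (mg.G i j * sin (θ i - θ j) - mg.B i j * cos (θ i - θ j)) := by
    intro j _
    have hVj := hbox j
    have h1 : |mg.G i j * sin (θ i - θ j) - mg.B i j * cos (θ i - θ j)| ≤ |mg.G i j| + |mg.B i j| := by
      calc |mg.G i j * sin (θ i - θ j) - mg.B i j * cos (θ i - θ j)|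
          ≤ |mg.G i j * sin (θ i - θ j)| + |mg.B i j * cos (θ i - θ j)| := abs_sub _ _
        _ ≤ |mg.G i j| + |mg.B i j| := by
          rw [abs_mul, abs_mul]
          exact add_le_add (mul_le_of_le_one_right (abs_nonneg _) (abs_sin_le_one _))
            (mul_le_of_le_one_right (abs_nonneg _) (abs_cos_le_one _))
    have h2 := neg_abs_le (mg.G i j * sin (θ i - θ j) - mg.B i j * cos (θ i - θ j))
    have hMV : 0 ≤ M * V j := mul_nonneg hM hVj.1
    have hMVle : M * V j ≤ M * M := mul_le_mul_of_nonneg_left hVj.2 hM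
    nlinarith [abs_nonneg (mg.G i j), abs_nonneg (mg.B i j)]
  have hs := sum_le_sum hterm
  rw [sum_neg_distrib] at hs
  have e0 : M * M * (mg.G i i * 0 - mg.B i i * 1) = M ^ 2 * -mg.B i i := by ring
  linarith [hs]

/-- The voltage component `V_i` of a solution is differentiable within the time set with derivative
`dV`. -/
theorem hasDerivWithinAt_voltage {γ : ℝ → State n} {s : Set ℝ} (h : mg.IsSolutionOn γ s) {t : ℝ}
    (ht : t ∈ s) (i : Fin n) :
    HasDerivWithinAt (fun τ => (γ τ).2.2 i) (mg.dV (γ t) i) s t := by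
  have h2 : HasDerivWithinAt (fun τ => (γ τ).2.2) ((mg.field (γ t)).2.2) s t := by
    simpa using (h t ht).hasFDerivWithinAt.snd.snd.hasDerivWithinAt
  simpa [field] using (hasDerivWithinAt_pi.1 h2) i

/-! ## §2 The invariant box -/

/-- **Invariant voltage box for the droop microgrid with Q–V dynamics (every `n`).** Assume
`τ_Qi > 0`, `λ^q_i ≥ 0`, `b_i = v_i⁰ + λ^q_i Q_i^set > 0` and weak susceptance dominance
`Σ_{j≠i} (|G_ij| + |B_ij|) ≤ −B_ii` for every node, and let `M > b_i` for all `i`. Then along every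
solution of (4a)–(4c) on `[0, T]` whose voltages start in `[0, M]^n`, the voltages STAY in `[0, M]^n`
on `[0, T]` — for arbitrary angle and frequency trajectories. MODELLED: [cite: KunduEtAl2019,
(4a)–(4c)] (MV-6N); an invariant box, not an attractor or a stability statement. -/
theorem voltage_box_invariant (hτ : ∀ i, 0 < mg.τQ i) (hkQ : ∀ i, 0 ≤ mg.kQ i)
    (hb : ∀ i, 0 < mg.Vset i + mg.kQ i * mg.Qset i)
    (hdom : ∀ i, ∑ j ∈ univ.erase i, (|mg.G i j| + |mg.B i j|) ≤ -mg.B i i)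
    {M : ℝ} (hM : ∀ i, mg.Vset i + mg.kQ i * mg.Qset i < M)
    {T : ℝ} {γ : ℝ → State n} (h : mg.IsSolutionOn γ (Icc 0 T))
    (h0 : ∀ i, 0 ≤ (γ 0).2.2 i ∧ (γ 0).2.2 i ≤ M) :
    ∀ t ∈ Icc 0 T, ∀ i, 0 ≤ (γ t).2.2 i ∧ (γ t).2.2 i ≤ M := by
  classical
  -- barrier functions: `inl i ↦ −V_i ≤ 0`, `inr i ↦ V_i ≤ M`
  set hf : Fin n ⊕ Fin n → ℝ → ℝ :=
    Sum.elim (fun i t => -(γ t).2.2 i) (fun i t => (γ t).2.2 i) with hhf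
  set hf' : Fin n ⊕ Fin n → ℝ → ℝ :=
    Sum.elim (fun i t => -mg.dV (γ t) i) (fun i t => mg.dV (γ t) i) with hhf'
  set c : Fin n ⊕ Fin n → ℝ := Sum.elim (fun _ => 0) (fun _ => M) with hc
  have hder : ∀ k, ∀ t ∈ Icc 0 T, HasDerivWithinAt (hf k) (hf' k t) (Icc 0 T) t := by
    rintro (i | i) t ht
    · show HasDerivWithinAt (fun τ => -(γ τ).2.2 i) (-mg.dV (γ t) i) (Icc 0 T) t
      exact (mg.hasDerivWithinAt_voltage h ht i).neg
    · show HasDerivWithinAt (fun τ => (γ τ).2.2 i) (mg.dV (γ t) i) (Icc 0 T) t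
      exact mg.hasDerivWithinAt_voltage h ht i
  have hface : ∀ t ∈ Icc 0 T, (∀ j, hf j t ≤ c j) → ∀ k, hf k t = c k → hf' k t < 0 := by
    intro t _ hall k hk
    have hbox : ∀ j, 0 ≤ (γ t).2.2 j ∧ (γ t).2.2 j ≤ M := fun j =>
      ⟨by have := hall (Sum.inl j); simp only [hhf, hc, Sum.elim_inl] at this; linarith,
       by have := hall (Sum.inr j); simpa [hhf, hc] using this⟩
    rcases k with i | i
    · -- lower face `V_i = 0`: `V̇_i = b_i/τ > 0`
      have hVi : (γ t).2.2 i = 0 := by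
        have := hk; simp only [hhf, hc, Sum.elim_inl] at this; linarith
      show -mg.dV (γ t) i < 0
      rw [mg.dV_at_zero (γ t) i hVi]
      have := div_pos (hb i) (hτ i)
      linarith
    · -- upper face `V_i = M`: `τ V̇_i ≤ b_i − M − λ^q Q_i < 0`
      have hVi : (γ t).2.2 i = M := by simpa [hhf, hc] using hk
      have hMpos : 0 ≤ M := ((hb i).trans (hM i)).le
      show mg.dV (γ t) i < 0
      have hQ := mg.Q_lower_at_top (γ t).1 (γ t).2.2 i hMpos hVi hbox
      have hd : 0 ≤ -mg.B i i - ∑ j ∈ univ.erase i, (|mg.G i j| + |mg.B i j|) := by linarith [hdom i]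
      have hQ0 : 0 ≤ mg.Q (γ t).1 (γ t).2.2 i := le_trans (by positivity) hQ
      have hnum : mg.Vset i - (γ t).2.2 i + mg.kQ i * (mg.Qset i - mg.Q (γ t).1 (γ t).2.2 i) < 0 := by
        rw [hVi]
        have := mul_nonneg (hkQ i) hQ0
        nlinarith [hM i]
      unfold dV
      exact div_neg_of_neg_of_pos hnum (hτ i)
  have h0' : ∀ k, hf k 0 ≤ c k := by
    rintro (i | i)
    · show -(γ 0).2.2 i ≤ 0; linarith [(h0 i).1]
    · show (γ 0).2.2 i ≤ M; exact (h0 i).2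
  intro t ht i
  have hle :=
    Literature.Analysis.ODE.forall_le_of_hasDerivWithinAt_of_eq_imp_deriv_neg hder hface h0' t ht
  refine ⟨?_, ?_⟩
  · have := hle (Sum.inl i); simp only [hhf, hc, Sum.elim_inl] at this; linarith
  · have := hle (Sum.inr i); simpa [hhf, hc] using this

/-- The same box for solutions on `[0, ∞)` (restrict to `[0, T]` for every `T`). -/
theorem voltage_box_invariant_Ici (hτ : ∀ i, 0 < mg.τQ i) (hkQ : ∀ i, 0 ≤ mg.kQ i)
    (hb : ∀ i, 0 < mg.Vset i + mg.kQ i * mg.Qset i)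
    (hdom : ∀ i, ∑ j ∈ univ.erase i, (|mg.G i j| + |mg.B i j|) ≤ -mg.B i i)
    {M : ℝ} (hM : ∀ i, mg.Vset i + mg.kQ i * mg.Qset i < M)
    {γ : ℝ → State n} (h : ∀ T : ℝ, mg.IsSolutionOn γ (Icc 0 T))
    (h0 : ∀ i, 0 ≤ (γ 0).2.2 i ∧ (γ 0).2.2 i ≤ M) {t : ℝ} (ht : 0 ≤ t) (i : Fin n) :
    0 ≤ (γ t).2.2 i ∧ (γ t).2.2 i ≤ M :=
  mg.voltage_box_invariant hτ hkQ hb hdom hM (h t) h0 t ⟨ht, le_rfl⟩ i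

/-! ## §3 Weighted boxes (M-matrix form of the dominance hypothesis)

Row dominance `Σ_{j≠i}(|G_ij| + |B_ij|) ≤ −B_ii` can fail narrowly on real reductions while a RESCALED box
still closes: it suffices that some positive weight vector `w` satisfies
`Σ_{j≠i} (|G_ij| + |B_ij|) w_j ≤ −B_ii w_i` for every `i` (the comparison matrix of the reduced admittance
is an M-matrix in the weak sense); then every box `Π_i [0, λ w_i]` with `λ w_i > b_i` is invariant. -/

/-- Weighted upper face: if `V_i = λ w_i` and every `V_j ∈ [0, λ w_j]` (`λ ≥ 0`, `w ≥ 0`), then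
`Q_i(θ, V) ≥ λ² w_i (−B_ii w_i − Σ_{j≠i} (|G_ij| + |B_ij|) w_j)` for all angles. -/
theorem Q_lower_at_top_weighted (θ V : Fin n → ℝ) (i : Fin n) {lam : ℝ} (hlam : 0 ≤ lam)
    {w : Fin n → ℝ} (hw : ∀ j, 0 ≤ w j) (hVi : V i = lam * w i)
    (hbox : ∀ j, 0 ≤ V j ∧ V j ≤ lam * w j) :
    lam ^ 2 * w i * (-mg.B i i * w i - ∑ j ∈ univ.erase i, (|mg.G i j| + |mg.B i j|) * w j)
      ≤ mg.Q θ V i := by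
  classical
  unfold Q
  rw [← Finset.add_sum_erase univ _ (mem_univ i)]
  simp only [sub_self, sin_zero, cos_zero, mul_zero, zero_sub, mul_one]
  rw [hVi, mul_sub, mul_sum]
  have hterm : ∀ j ∈ univ.erase i,
      -(lam ^ 2 * w i * ((|mg.G i j| + |mg.B i j|) * w j))
        ≤ lam * w i * V j * (mg.G i j * sin (θ i - θ j) - mg.B i j * cos (θ i - θ j)) := by
    intro j _
    have hVj := hbox j
    have h1 : |mg.G i j * sin (θ i - θ j) - mg.B i j * cos (θ i - θ j)| ≤ |mg.G i j| + |mg.B i j| := by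
      calc |mg.G i j * sin (θ i - θ j) - mg.B i j * cos (θ i - θ j)|
          ≤ |mg.G i j * sin (θ i - θ j)| + |mg.B i j * cos (θ i - θ j)| := abs_sub _ _
        _ ≤ |mg.G i j| + |mg.B i j| := by
          rw [abs_mul, abs_mul]
          exact add_le_add (mul_le_of_le_one_right (abs_nonneg _) (abs_sin_le_one _))
            (mul_le_of_le_one_right (abs_nonneg _) (abs_cos_le_one _))
    have h2 := neg_abs_le (mg.G i j * sin (θ i - θ j) - mg.B i j * cos (θ i - θ j))
    have hlw : 0 ≤ lam * w i := mul_nonneg hlam (hw i)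
    have hMV : 0 ≤ lam * w i * V j := mul_nonneg hlw hVj.1
    have hMVle : lam * w i * V j ≤ lam * w i * (lam * w j) := mul_le_mul_of_nonneg_left hVj.2 hlw
    nlinarith [abs_nonneg (mg.G i j), abs_nonneg (mg.B i j)]
  have hs := sum_le_sum hterm
  rw [sum_neg_distrib] at hs
  have e0 : lam * w i * (lam * w i) * (mg.G i i * 0 - mg.B i i * 1) = lam ^ 2 * w i * (-mg.B i i * w i) := by
    ring
  have e1 : ∑ j ∈ univ.erase i, lam ^ 2 * w i * ((|mg.G i j| + |mg.B i j|) * w j)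
      = lam ^ 2 * w i * ∑ j ∈ univ.erase i, (|mg.G i j| + |mg.B i j|) * w j := by rw [mul_sum]
  linarith [hs]

/-- **Invariant WEIGHTED voltage box (every `n`).** Assume `τ_Qi > 0`, `λ^q_i ≥ 0`,
`b_i = v_i⁰ + λ^q_i Q_i^set > 0`, and a positive weight vector `w` with
`Σ_{j≠i} (|G_ij| + |B_ij|) w_j ≤ −B_ii w_i` for every node (weak M-matrix dominance of the reduced
admittance). Then for every `λ` with `λ w_i > b_i` for all `i`, the box `Π_i [0, λ w_i]` is positively
invariant along every solution of (4a)–(4c) on `[0, T]` — angles and frequencies arbitrary. The unweighted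
`voltage_box_invariant` is the case `w ≡ 1`. MODELLED: [cite: KunduEtAl2019, (4a)–(4c)] (MV-6N). -/
theorem voltage_wbox_invariant (hτ : ∀ i, 0 < mg.τQ i) (hkQ : ∀ i, 0 ≤ mg.kQ i)
    (hb : ∀ i, 0 < mg.Vset i + mg.kQ i * mg.Qset i)
    {w : Fin n → ℝ} (hw : ∀ i, 0 < w i)
    (hdom : ∀ i, ∑ j ∈ univ.erase i, (|mg.G i j| + |mg.B i j|) * w j ≤ -mg.B i i * w i)
    {lam : ℝ} (hlam : ∀ i, mg.Vset i + mg.kQ i * mg.Qset i < lam * w i)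
    {T : ℝ} {γ : ℝ → State n} (h : mg.IsSolutionOn γ (Icc 0 T))
    (h0 : ∀ i, 0 ≤ (γ 0).2.2 i ∧ (γ 0).2.2 i ≤ lam * w i) :
    ∀ t ∈ Icc 0 T, ∀ i, 0 ≤ (γ t).2.2 i ∧ (γ t).2.2 i ≤ lam * w i := by
  classical
  set hf : Fin n ⊕ Fin n → ℝ → ℝ :=
    Sum.elim (fun i t => -(γ t).2.2 i) (fun i t => (γ t).2.2 i) with hhf
  set hf' : Fin n ⊕ Fin n → ℝ → ℝ :=
    Sum.elim (fun i t => -mg.dV (γ t) i) (fun i t => mg.dV (γ t) i) with hhf'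
  set c : Fin n ⊕ Fin n → ℝ := Sum.elim (fun _ => 0) (fun i => lam * w i) with hc
  have hder : ∀ k, ∀ t ∈ Icc 0 T, HasDerivWithinAt (hf k) (hf' k t) (Icc 0 T) t := by
    rintro (i | i) t ht
    · show HasDerivWithinAt (fun τ => -(γ τ).2.2 i) (-mg.dV (γ t) i) (Icc 0 T) t
      exact (mg.hasDerivWithinAt_voltage h ht i).neg
    · show HasDerivWithinAt (fun τ => (γ τ).2.2 i) (mg.dV (γ t) i) (Icc 0 T) t
      exact mg.hasDerivWithinAt_voltage h ht i
  have hface : ∀ t ∈ Icc 0 T, (∀ j, hf j t ≤ c j) → ∀ k, hf k t = c k → hf' k t < 0 := by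
    intro t _ hall k hk
    have hbox : ∀ j, 0 ≤ (γ t).2.2 j ∧ (γ t).2.2 j ≤ lam * w j := fun j =>
      ⟨by have := hall (Sum.inl j); simp only [hhf, hc, Sum.elim_inl] at this; linarith,
       by have := hall (Sum.inr j); simpa [hhf, hc] using this⟩
    rcases k with i | i
    · have hVi : (γ t).2.2 i = 0 := by
        have := hk; simp only [hhf, hc, Sum.elim_inl] at this; linarith
      show -mg.dV (γ t) i < 0
      rw [mg.dV_at_zero (γ t) i hVi]
      have := div_pos (hb i) (hτ i)
      linarith
    · have hVi : (γ t).2.2 i = lam * w i := by simpa [hhf, hc] using hk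
      have hlam0 : 0 ≤ lam := by
        have h1 : 0 < lam * w i := (hb i).trans (hlam i)
        by_contra hneg
        push Not at hneg
        have : lam * w i ≤ 0 := mul_nonpos_of_nonpos_of_nonneg hneg.le (hw i).le
        linarith
      show mg.dV (γ t) i < 0
      have hQ := mg.Q_lower_at_top_weighted (γ t).1 (γ t).2.2 i hlam0 (fun j => (hw j).le) hVi hbox
      have hd : 0 ≤ -mg.B i i * w i - ∑ j ∈ univ.erase i, (|mg.G i j| + |mg.B i j|) * w j := by
        linarith [hdom i]
      have hQ0 : 0 ≤ mg.Q (γ t).1 (γ t).2.2 i :=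
        le_trans (mul_nonneg (mul_nonneg (sq_nonneg _) (hw i).le) hd) hQ
      have hnum : mg.Vset i - (γ t).2.2 i + mg.kQ i * (mg.Qset i - mg.Q (γ t).1 (γ t).2.2 i) < 0 := by
        rw [hVi]
        have := mul_nonneg (hkQ i) hQ0
        nlinarith [hlam i]
      unfold dV
      exact div_neg_of_neg_of_pos hnum (hτ i)
  have h0' : ∀ k, hf k 0 ≤ c k := by
    rintro (i | i)
    · show -(γ 0).2.2 i ≤ 0; linarith [(h0 i).1]
    · show (γ 0).2.2 i ≤ lam * w i; exact (h0 i).2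
  intro t ht i
  have hle :=
    Literature.Analysis.ODE.forall_le_of_hasDerivWithinAt_of_eq_imp_deriv_neg hder hface h0' t ht
  refine ⟨?_, ?_⟩
  · have := hle (Sum.inl i); simp only [hhf, hc, Sum.elim_inl] at this; linarith
  · have := hle (Sum.inr i); simpa [hhf, hc] using this

/-! ## §4 Two-sided bands: voltages bounded AWAY FROM ZERO -/

/-- `|G_ij sin θ_ij − B_ij cos θ_ij| ≤ |G_ij| + |B_ij|`. -/
theorem abs_gQ_le (θ : Fin n → ℝ) (i j : Fin n) :
    |mg.G i j * sin (θ i - θ j) - mg.B i j * cos (θ i - θ j)| ≤ |mg.G i j| + |mg.B i j| := by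
  refine (abs_sub _ _).trans ?_
  rw [abs_mul, abs_mul]
  exact add_le_add (mul_le_of_le_one_right (abs_nonneg _) (abs_sin_le_one _))
    (mul_le_of_le_one_right (abs_nonneg _) (abs_cos_le_one _))

/-- Lower face at a positive level: if `0 ≤ ℓ = V_i` and every `V_j ∈ [0, λ w_j]`, then
`Q_i(θ, V) ≤ −B_ii ℓ² + ℓ λ Σ_{j≠i} (|G_ij| + |B_ij|) w_j` for all angles. -/
theorem Q_upper_at_bottom (θ V : Fin n → ℝ) (i : Fin n) {ℓ lam : ℝ} (hℓ : 0 ≤ ℓ)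
    {w : Fin n → ℝ} (hVi : V i = ℓ) (hbox : ∀ j, 0 ≤ V j ∧ V j ≤ lam * w j) :
    mg.Q θ V i ≤ -mg.B i i * ℓ ^ 2 + ℓ * lam * ∑ j ∈ univ.erase i, (|mg.G i j| + |mg.B i j|) * w j := by
  classical
  unfold Q
  rw [← Finset.add_sum_erase univ _ (mem_univ i)]
  simp only [sub_self, sin_zero, cos_zero, mul_zero, zero_sub, mul_one]
  rw [hVi, mul_sum]
  have hterm : ∀ j ∈ univ.erase i, ℓ * V j * (mg.G i j * sin (θ i - θ j) - mg.B i j * cos (θ i - θ j))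
      ≤ ℓ * lam * ((|mg.G i j| + |mg.B i j|) * w j) := by
    intro j _
    have h1 := mg.abs_gQ_le θ i j
    have h2 := le_abs_self (mg.G i j * sin (θ i - θ j) - mg.B i j * cos (θ i - θ j))
    have hMV : 0 ≤ ℓ * V j := mul_nonneg hℓ (hbox j).1
    have hMVle : ℓ * V j ≤ ℓ * (lam * w j) := mul_le_mul_of_nonneg_left (hbox j).2 hℓ
    nlinarith [abs_nonneg (mg.G i j), abs_nonneg (mg.B i j)]
  have hs := sum_le_sum hterm
  have e0 : ℓ * ℓ * (mg.G i i * 0 - mg.B i i * 1) = -mg.B i i * ℓ ^ 2 := by ring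
  have e1 : ∑ j ∈ univ.erase i, ℓ * lam * ((|mg.G i j| + |mg.B i j|) * w j)
      = ℓ * lam * ∑ j ∈ univ.erase i, (|mg.G i j| + |mg.B i j|) * w j := by rw [mul_sum]
  linarith [hs]

/-- **Invariant two-sided voltage BAND (every `n`): voltages stay bounded away from zero.** Assume
`τ_Qi > 0`, `λ^q_i ≥ 0`, positive weights with `Σ_{j≠i} (|G_ij| + |B_ij|) w_j ≤ −B_ii w_i`, an upper
level with `b_i = v_i⁰ + λ^q_i Q_i^set < λ w_i`, and lower levels `ℓ_i ≥ 0` with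
`ℓ_i + λ^q_i ℓ_i (−B_ii ℓ_i + λ Σ_{j≠i} (|G_ij| + |B_ij|) w_j) < b_i`. Then the band `Π_i [ℓ_i, λ w_i]` is
positively invariant along every solution of (4a)–(4c) on `[0, T]` — angles and frequencies arbitrary
(`ℓ ≡ 0` is §3). MODELLED: [cite: KunduEtAl2019, (4a)–(4c)] (MV-6N); a band, not an attractor. -/
theorem voltage_band_invariant (hτ : ∀ i, 0 < mg.τQ i) (hkQ : ∀ i, 0 ≤ mg.kQ i)
    {w : Fin n → ℝ} (hw : ∀ i, 0 < w i)
    (hdom : ∀ i, ∑ j ∈ univ.erase i, (|mg.G i j| + |mg.B i j|) * w j ≤ -mg.B i i * w i)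
    {lam : ℝ} (hlam : ∀ i, mg.Vset i + mg.kQ i * mg.Qset i < lam * w i)
    {ℓ : Fin n → ℝ} (hℓ0 : ∀ i, 0 ≤ ℓ i)
    (hℓ : ∀ i, ℓ i + mg.kQ i * ℓ i *
        (-mg.B i i * ℓ i + lam * ∑ j ∈ univ.erase i, (|mg.G i j| + |mg.B i j|) * w j)
        < mg.Vset i + mg.kQ i * mg.Qset i)
    {T : ℝ} {γ : ℝ → State n} (h : mg.IsSolutionOn γ (Icc 0 T))
    (h0 : ∀ i, ℓ i ≤ (γ 0).2.2 i ∧ (γ 0).2.2 i ≤ lam * w i) :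
    ∀ t ∈ Icc 0 T, ∀ i, ℓ i ≤ (γ t).2.2 i ∧ (γ t).2.2 i ≤ lam * w i := by
  classical
  set hf : Fin n ⊕ Fin n → ℝ → ℝ :=
    Sum.elim (fun i t => -(γ t).2.2 i) (fun i t => (γ t).2.2 i) with hhf
  set hf' : Fin n ⊕ Fin n → ℝ → ℝ :=
    Sum.elim (fun i t => -mg.dV (γ t) i) (fun i t => mg.dV (γ t) i) with hhf'
  set c : Fin n ⊕ Fin n → ℝ := Sum.elim (fun i => -ℓ i) (fun i => lam * w i) with hc
  have hder : ∀ k, ∀ t ∈ Icc 0 T, HasDerivWithinAt (hf k) (hf' k t) (Icc 0 T) t := by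
    rintro (i | i) t ht
    · show HasDerivWithinAt (fun τ => -(γ τ).2.2 i) (-mg.dV (γ t) i) (Icc 0 T) t
      exact (mg.hasDerivWithinAt_voltage h ht i).neg
    · show HasDerivWithinAt (fun τ => (γ τ).2.2 i) (mg.dV (γ t) i) (Icc 0 T) t
      exact mg.hasDerivWithinAt_voltage h ht i
  have hface : ∀ t ∈ Icc 0 T, (∀ j, hf j t ≤ c j) → ∀ k, hf k t = c k → hf' k t < 0 := by
    intro t _ hall k hk
    have hband : ∀ j, ℓ j ≤ (γ t).2.2 j ∧ (γ t).2.2 j ≤ lam * w j := fun j =>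
      ⟨by have := hall (Sum.inl j); simp only [hhf, hc, Sum.elim_inl] at this; linarith,
       by have := hall (Sum.inr j); simpa [hhf, hc] using this⟩
    have hbox : ∀ j, 0 ≤ (γ t).2.2 j ∧ (γ t).2.2 j ≤ lam * w j := fun j =>
      ⟨(hℓ0 j).trans (hband j).1, (hband j).2⟩
    have hlam0 : ∀ i : Fin n, 0 ≤ lam := fun i => by
      by_contra hneg
      push Not at hneg
      have := mul_neg_of_neg_of_pos hneg (hw i)
      linarith [hℓ0 i, (hband i).1, (hband i).2]
    rcases k with i | i
    · have hVi : (γ t).2.2 i = ℓ i := by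
        have := hk; simp only [hhf, hc, Sum.elim_inl] at this; linarith
      show -mg.dV (γ t) i < 0
      have hQ := mul_le_mul_of_nonneg_left
        (mg.Q_upper_at_bottom (γ t).1 (γ t).2.2 i (hℓ0 i) hVi hbox) (hkQ i)
      have hnum : 0 < mg.Vset i - (γ t).2.2 i + mg.kQ i * (mg.Qset i - mg.Q (γ t).1 (γ t).2.2 i) := by
        rw [hVi]; have := hℓ i; nlinarith
      unfold dV
      linarith [div_pos hnum (hτ i)]
    · have hVi : (γ t).2.2 i = lam * w i := by simpa [hhf, hc] using hk
      show mg.dV (γ t) i < 0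
      have hQ := mg.Q_lower_at_top_weighted (γ t).1 (γ t).2.2 i (hlam0 i) (fun j => (hw j).le) hVi hbox
      have hd : 0 ≤ -mg.B i i * w i - ∑ j ∈ univ.erase i, (|mg.G i j| + |mg.B i j|) * w j := by
        linarith [hdom i]
      have hQ0 : 0 ≤ mg.Q (γ t).1 (γ t).2.2 i :=
        le_trans (mul_nonneg (mul_nonneg (sq_nonneg _) (hw i).le) hd) hQ
      have hnum : mg.Vset i - (γ t).2.2 i + mg.kQ i * (mg.Qset i - mg.Q (γ t).1 (γ t).2.2 i) < 0 := by
        rw [hVi]; have := mul_nonneg (hkQ i) hQ0; nlinarith [hlam i]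
      unfold dV
      exact div_neg_of_neg_of_pos hnum (hτ i)
  have h0' : ∀ k, hf k 0 ≤ c k := by
    rintro (i | i)
    · show -(γ 0).2.2 i ≤ -ℓ i; linarith [(h0 i).1]
    · show (γ 0).2.2 i ≤ lam * w i; exact (h0 i).2
  intro t ht i
  have hle :=
    Literature.Analysis.ODE.forall_le_of_hasDerivWithinAt_of_eq_imp_deriv_neg hder hface h0' t ht
  refine ⟨?_, ?_⟩
  · have := hle (Sum.inl i); simp only [hhf, hc, Sum.elim_inl] at this; linarith
  · have := hle (Sum.inr i); simpa [hhf, hc] using this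

end Summit.Ventures.GridStability.Models.DroopMicrogrid

end
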